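import Literature.Geometry.Lorentzian.GeodesicExistence
import HarnessLib

/-!
# Uniform existence time for geodesics on compact sets of initial data

For a `C¹` covariant derivative `cov` on the tangent bundle of a Hausdorff manifold `M`
(finite-dimensional complete model space) this file proves the quantitative form of local
existence of geodesics that drives every extension argument (O'Neill, *Semi-Riemannian geometry*
(1983), Ch. 3, Lemma 22 with the "standard" dependence of ODE solutions on initial conditions;
Lee, *Introduction to Riemannian Manifolds* (2018), Lemma 6.19 / Thm. 4.27 (c): "for every
compact `K ⊆ TM` there is `ε > 0` such that every geodesic with initial data in `K` is defined on
`(-ε, ε)`"):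

* `exists_nhds_uniform_isGeodesicOn`: every point `p₀` of `TM` over an interior point has a
  neighbourhood `𝒰` and an `ε > 0` such that every `p ∈ 𝒰` is the tangent lift at `0` of a
  geodesic defined on `(-ε, ε)`;
* `exists_uniform_isGeodesicOn_of_isCompact`: the same with `𝒰` replaced by any compact set of
  initial data (boundaryless `M`), by a finite subcover.

## Proof

As in `GeodesicExistence.lean` (O'Neill's proof of Lemma 22 through Cor. 21), geodesics near
`x₁ = π p₀` are produced from solutions of the first-order system
`(u, w)' = F(u, w) = (w, -∑ᵢ wⁱ Ĉᵢ(φ⁻¹ u) w)` in the chart `φ` at `x₁`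
(`isGeodesicOn_of_chartSolution`, the computation of `exists_isGeodesicOn_nhds_zero_holds`
isolated: a solution staying in a chart ball `O` on an open set of times is a geodesic there, with
velocity components `w`). Uniformity comes from the Lipschitz-flow form of the Picard–Lindelöf
theorem (Mathlib's `IsPicardLindelof.exists_forall_mem_closedBall_eq_hasDerivWithinAt_lipschitzOnWith`
with the constants of `IsPicardLindelof.of_contDiffAt_one`): all solutions with initial value in a
closed ball around `z₀ = (φ x₁, (p₀)_φ)` exist on a fixed time interval and depend Lipschitz
continuously on the initial value, so — the solution through `z₀` being continuous — they all
stay in the chart ball `O` for a fixed positive time; the initial values `(φ π p, p_φ)` of nearby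
`p ∈ TM` lie in that closed ball by continuity of the chart of `TM`.

## References

* B. O'Neill, *Semi-Riemannian geometry with applications to relativity*, Academic Press 1983,
  Ch. 3, Cor. 21 and Lemma 22 (pp. 67–68).
* J. M. Lee, *Introduction to Riemannian Manifolds*, 2nd ed., Springer GTM 176 (2018), Thm. 4.27
  and Lemma 6.19 (uniform time / escape lemma).
-/

noncomputable section

open Bundle Set Filter Metric
open scoped Manifold ContDiff Topology NNReal

namespace Literature.Geometry.Lorentzian

variable {E : Type*} [NormedAddCommGroup E] [NormedSpace ℝ E] {H : Type*} [TopologicalSpace H]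
  {I : ModelWithCorners ℝ E H} {M : Type*} [TopologicalSpace M] [ChartedSpace H M]
  [IsManifold I ∞ M] [FiniteDimensional ℝ E]
  {cov : CovariantDerivative I E (TangentSpace I : M → Type _)}

omit [IsManifold I ∞ M] [FiniteDimensional ℝ E] in
/-- **A chart ball.** For an interior point `x₁` and an open neighbourhood `N` of `x₁` there is
an open set `O` in the model space containing `φ x₁` (`φ = extChartAt I x₁`), contained in the
target of `φ`, mapped into `N` by `φ⁻¹`, and consisting of interior points of `range I` (so that
`φ⁻¹` is differentiable at its points). [folklore] -/
theorem exists_chartBall {x₁ : M} (hx : I.IsInteriorPoint x₁) {N : Set M} (hN : IsOpen N)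
    (hxN : x₁ ∈ N) :
    ∃ O : Set E, IsOpen O ∧ extChartAt I x₁ x₁ ∈ O ∧ O ⊆ (extChartAt I x₁).target ∧
      (∀ z ∈ O, (extChartAt I x₁).symm z ∈ N) ∧ ∀ z ∈ O, range I ∈ 𝓝 z := by
  set φ := extChartAt I x₁ with hφ_def
  have hrx : range I ∈ 𝓝 (φ x₁) := range_mem_nhds_isInteriorPoint hx
  refine ⟨interior (φ.target ∩ φ.symm ⁻¹' N) ∩ interior (range I),
    isOpen_interior.inter isOpen_interior, ⟨?_, mem_interior_iff_mem_nhds.2 hrx⟩,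
    fun z hz ↦ (interior_subset hz.1).1, fun z hz ↦ (interior_subset hz.1).2,
    fun z hz ↦ mem_interior_iff_mem_nhds.1 hz.2⟩
  rw [mem_interior_iff_mem_nhds]
  have h1 : φ.target ∈ 𝓝 (φ x₁) := by
    have h := extChartAt_target_mem_nhdsWithin' (I := I) (mem_extChartAt_source x₁)
    rwa [nhdsWithin_eq_nhds.2 hrx] at h
  have h2 : φ.symm ⁻¹' N ∈ 𝓝[φ.target] (φ x₁) := by
    have hc : ContinuousWithinAt φ.symm φ.target (φ x₁) :=
      (continuousOn_extChartAt_symm x₁) _ (mem_extChartAt_target x₁)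
    refine hc.preimage_mem_nhdsWithin ?_
    rw [hφ_def, extChartAt_to_inv]
    exact hN.mem_nhds hxN
  rw [nhdsWithin_eq_nhds.2 h1] at h2
  exact inter_mem h1 h2

/-- **Solutions of the geodesic system in a chart are geodesics** (O'Neill 1983, Ch. 3, Cor. 21
and the proof of Lemma 22, pp. 67–68; the verification step of
`exists_isGeodesicOn_nhds_zero_holds`, isolated for reuse). Let `Ĉᵢ` read `w ↦ ∇_w sᵢ` in the
trivialisation `e₁` at `x₁` on `N` (as provided by `exists_christoffelChart`), let `O` be a chart
ball as in `exists_chartBall`, and let `f = (u, w) : ℝ → E × E` solve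
`(u, w)' = (w, -∑ᵢ wⁱ Ĉᵢ(φ⁻¹ u) w)` at every time of an open set `s` on which `u` stays in `O`.
Then `γ = φ⁻¹ ∘ u` is a geodesic of `cov` on `s`, and its velocity read in `e₁` is `w`: the
chain rule identifies `(φ ∘ γ)' = u' = w` with the `e₁`-components of `γ'`, so the tangent lift is
differentiable, and the acceleration vanishes by `continuousLinearMapAt_covariantDerivAlong_velocity`.
[cite: ONeill1983, Ch. 3, Cor. 21] -/
theorem isGeodesicOn_of_chartSolution
    {ι : Type*} [Fintype ι] (b : Module.Basis ι ℝ E) {x₁ : M} {N : Set M}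
    (hNs : N ⊆ (chartAt H x₁).source) (Ĉ : ι → M → (E →L[ℝ] E))
    (hĈ : ∀ y ∈ N, ∀ (i) (w : TangentSpace I y),
      Ĉ i y ((trivializationAt E (TangentSpace I) x₁).continuousLinearMapAt ℝ y w) =
        (trivializationAt E (TangentSpace I) x₁
          ⟨y, cov ((trivializationAt E (TangentSpace I) x₁).localFrame b i) y w⟩).2)
    {O : Set E} (hO : IsOpen O) (hOt : O ⊆ (extChartAt I x₁).target)
    (hON : ∀ z ∈ O, (extChartAt I x₁).symm z ∈ N) (hOr : ∀ z ∈ O, range I ∈ 𝓝 z)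
    {f : ℝ → E × E} {s : Set ℝ} (hs : IsOpen s)
    (hf : ∀ t ∈ s, HasDerivAt f
      ((f t).2, -∑ i, b.repr (f t).2 i • Ĉ i ((extChartAt I x₁).symm (f t).1) (f t).2) t)
    (hfO : ∀ t ∈ s, (f t).1 ∈ O) :
    IsGeodesicOn cov (fun t ↦ (extChartAt I x₁).symm (f t).1) s ∧
      ∀ t ∈ s, (trivializationAt E (TangentSpace I) x₁
        (tangentLift I (fun t ↦ (extChartAt I x₁).symm (f t).1) t)).2 = (f t).2 := by
  set φ := extChartAt I x₁ with hφ_def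
  set e₁ := trivializationAt E (TangentSpace I : M → Type _) x₁ with he₁_def
  set u : ℝ → E := fun t ↦ (f t).1 with hu_def
  set w : ℝ → E := fun t ↦ (f t).2 with hw_def
  set γ : ℝ → M := fun t ↦ φ.symm (u t) with hγ_def
  have hu : ∀ t ∈ s, HasDerivAt u (w t) t := fun t ht ↦
    (ContinuousLinearMap.fst ℝ E E).hasFDerivAt.comp_hasDerivAt t (hf t ht)
  have hw : ∀ t ∈ s, HasDerivAt w (-∑ i, b.repr (w t) i • Ĉ i (γ t) (w t)) t := fun t ht ↦
    (ContinuousLinearMap.snd ℝ E E).hasFDerivAt.comp_hasDerivAt t (hf t ht)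
  -- pointwise facts along `s`
  have hsrc : ∀ t ∈ s, γ t ∈ (chartAt H x₁).source := fun t ht ↦ by
    rw [← extChartAt_source I]
    exact φ.map_target (hOt (hfO t ht))
  have hγd : ∀ t ∈ s, MDifferentiableAt 𝓘(ℝ, ℝ) I γ t := fun t ht ↦
    ((mdifferentiableWithinAt_extChartAt_symm (hOt (hfO t ht))).mdifferentiableAt
      (hOr _ (hfO t ht))).comp t (mdifferentiableAt_iff_differentiableAt.2 (hu t ht).differentiableAt)
  have hUeq : ∀ t ∈ s, (e₁ (tangentLift I γ t)).2 = w t := by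
    intro t ht
    have h1 : HasDerivAt (extChartAt I x₁ ∘ γ) ((e₁ ⟨γ t, velocity I γ t⟩).2) t :=
      hasDerivAt_extChartAt_comp (hγd t ht) (hsrc t ht)
    have h2 : (extChartAt I x₁ ∘ γ) =ᶠ[𝓝 t] u := by
      have hO' : ∀ᶠ t' in 𝓝 t, u t' ∈ O :=
        (hu t ht).continuousAt.preimage_mem_nhds (hO.mem_nhds (hfO t ht))
      filter_upwards [hO'] with t' ht'
      exact φ.right_inv (hOt ht')
    exact h1.unique ((hu t ht).congr_of_eventuallyEq h2)
  have hUev : ∀ t ∈ s, (fun t' ↦ (e₁ (tangentLift I γ t')).2) =ᶠ[𝓝 t] w := fun t ht ↦ by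
    filter_upwards [hs.mem_nhds ht] with t' ht'
    exact hUeq t' ht'
  have hLd : ∀ t ∈ s, MDifferentiableAt 𝓘(ℝ, ℝ) I.tangent (tangentLift I γ) t := by
    intro t ht
    have hm : tangentLift I γ t ∈ e₁.source :=
      e₁.mem_source.2 (by simpa [he₁_def] using hsrc t ht)
    refine (e₁.mdifferentiableAt_totalSpace_iff I (tangentLift I γ) hm).2 ⟨hγd t ht, ?_⟩
    exact mdifferentiableAt_iff_differentiableAt.2
      ((hw t ht).differentiableAt.congr_of_eventuallyEq (hUev t ht))
  have hgeo : ∀ t ∈ s, covariantDerivAlong cov γ (fun t ↦ velocity I γ t) t = 0 := by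
    intro t ht
    have hte : γ t ∈ e₁.baseSet := by simpa [he₁_def] using hsrc t ht
    have hA := continuousLinearMapAt_covariantDerivAlong_velocity (cov := cov) b hNs Ĉ hĈ
      (hON _ (hfO t ht)) (hLd t ht)
    rw [(hUev t ht).deriv_eq, (hw t ht).deriv, hUeq t ht, neg_add_cancel] at hA
    have hinj : Function.Injective (e₁.continuousLinearMapAt ℝ (γ t)) := by
      rw [← Trivialization.coe_continuousLinearEquivAt_eq e₁ hte]
      exact (e₁.continuousLinearEquivAt ℝ (γ t) hte).injective
    exact hinj (by rw [hA, map_zero])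
  exact ⟨⟨hLd, hgeo⟩, hUeq⟩

omit [FiniteDimensional ℝ E] in
/-- Two points of `TM` over the domain of a trivialisation `e₁` with the same base point and the
same fibre coordinate in `e₁` are equal (injectivity of `e₁` on its source). [folklore] -/
theorem eq_of_trivializationAt_snd_eq {x₁ : M} {p q : TangentBundle I M}
    (hp : p.proj ∈ (chartAt H x₁).source) (h₁ : p.proj = q.proj)
    (h₂ : (trivializationAt E (TangentSpace I) x₁ p).2 =
      (trivializationAt E (TangentSpace I) x₁ q).2) : p = q := by
  set e₁ := trivializationAt E (TangentSpace I : M → Type _) x₁ with he₁_def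
  have hm : p ∈ e₁.source := e₁.mem_source.2 (by simpa [he₁_def] using hp)
  have hm' : q ∈ e₁.source := e₁.mem_source.2 (by simpa [he₁_def, ← h₁] using hp)
  have h : e₁ p = e₁ q := Prod.ext (by rw [e₁.coe_fst hm, e₁.coe_fst hm']; exact h₁) h₂
  exact e₁.injOn hm hm' h

/-- **Uniform existence time near a point of `TM`** (O'Neill 1983, Ch. 3, Lemma 22 with the
standard uniformity of the existence interval in the initial data; Lee, *Introduction to
Riemannian Manifolds* (2018), Thm. 4.27 (c)). For a `C¹` connection on a Hausdorff manifold
and a point `p₀ ∈ TM` over an interior point, there are a neighbourhood `𝒰` of `p₀` in `TM` and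
`ε > 0` such that every `p ∈ 𝒰` is the tangent lift at `0` of a geodesic of `cov` defined on
`(-ε, ε)`. Proof: the Lipschitz flow of the geodesic system in the chart at `π p₀`
(Picard–Lindelöf) exists for all initial values in a closed ball around `(φ π p₀, (p₀)_φ)` on a
fixed time interval; by Lipschitz dependence on the initial value and continuity of the solution
through the centre, all these solutions stay in a chart ball for a fixed positive time, where they
are geodesics (`isGeodesicOn_of_chartSolution`); the chart of `TM` is continuous, so nearby `p`
have initial values in the closed ball. [cite: ONeill1983, Ch. 3, Lemma 22] -/
theorem exists_nhds_uniform_isGeodesicOn [CompleteSpace E] [T2Space M]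
    [CovariantDerivative.ContMDiffCovariantDerivative cov 1]
    (p₀ : TangentBundle I M) (hx : I.IsInteriorPoint p₀.proj) :
    ∃ 𝒰 ∈ 𝓝 p₀, ∃ ε > (0 : ℝ), ∀ p ∈ 𝒰, ∃ γ : ℝ → M,
      IsGeodesicOn cov γ (Ioo (-ε) ε) ∧ tangentLift I γ 0 = p := by
  set x₁ := p₀.proj with hx₁_def
  set b := Module.finBasis ℝ E with hb_def
  obtain ⟨N, Ĉ, hN, hxN, hNs, hĈ, hĈs⟩ := exists_christoffelChart (cov := cov) b x₁
  set φ := extChartAt I x₁ with hφ_def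
  set e₁ := trivializationAt E (TangentSpace I : M → Type _) x₁ with he₁_def
  obtain ⟨O, hO, hxO, hOt, hON, hOr⟩ := exists_chartBall hx hN hxN
  -- the first-order system, `C¹` at every point over `φ x₁`
  set G : E × E → E := fun pq ↦ -∑ i, b.repr pq.2 i • Ĉ i (φ.symm pq.1) pq.2 with hG_def
  set F : E × E → E × E := fun pq ↦ (pq.2, G pq) with hF_def
  have hF : ∀ q : E, ContDiffAt ℝ 1 F (φ x₁, q) := by
    intro q
    have hG : ContDiffAt ℝ 1 G (φ x₁, q) := by
      have h1 : ∀ i, ContDiffAt ℝ 1 (fun pq : E × E ↦ Ĉ i (φ.symm pq.1)) (φ x₁, q) := by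
        intro i
        have h2 : ContMDiffWithinAt 𝓘(ℝ, E) 𝓘(ℝ, E →L[ℝ] E) 1 (Ĉ i ∘ φ.symm) (range I)
            (φ x₁) := by
          refine ContMDiffAt.comp_contMDiffWithinAt _ ?_
            (contMDiffWithinAt_extChartAt_symm_range x₁ (mem_extChartAt_target x₁))
          rw [hφ_def, extChartAt_to_inv]
          exact hĈs i
        have h3 : ContDiffAt ℝ 1 (Ĉ i ∘ φ.symm) (φ x₁) :=
          (contMDiffWithinAt_iff_contDiffWithinAt.mp h2).contDiffAt
            (range_mem_nhds_isInteriorPoint hx)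
        exact ContDiffAt.comp (f := Prod.fst) (φ x₁, q) h3 contDiffAt_fst
      have h4 : ∀ i, ContDiffAt ℝ 1 (fun pq : E × E ↦ b.repr pq.2 i) (φ x₁, q) := fun i ↦
        (((b.coord i).toContinuousLinearMap).contDiff.comp contDiff_snd).contDiffAt
      exact (ContDiffAt.sum fun i _ ↦ (h4 i).smul ((h1 i).clm_apply contDiffAt_snd)).neg
    exact contDiffAt_snd.prodMk hG
  -- the Lipschitz flow around `z₀`
  set z₀ : E × E := (φ x₁, (e₁ p₀).2) with hz₀_def
  obtain ⟨ε₀, hε₀, a, r, L, K, hr, hpl⟩ := IsPicardLindelof.of_contDiffAt_one (hF (e₁ p₀).2)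
  obtain ⟨α, hα, L', hL'⟩ :=
    (hpl 0).exists_forall_mem_closedBall_eq_hasDerivWithinAt_lipschitzOnWith
  simp only [zero_sub, zero_add] at hα hL'
  have hz₀ : z₀ ∈ closedBall z₀ r := mem_closedBall_self r.2
  -- all nearby solutions stay in the chart ball for a fixed positive time
  obtain ⟨δ, hδ, hδO⟩ := Metric.isOpen_iff.1 hO z₀.1 hxO
  have hcont : ContinuousAt (α z₀) 0 := by
    have h := ((hα z₀ hz₀).2 0 ⟨by linarith, hε₀.le⟩).continuousWithinAt
    exact h.continuousAt (Icc_mem_nhds (by linarith) hε₀)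
  obtain ⟨ε₁, hε₁, hε₁δ⟩ := Metric.continuousAt_iff.1 hcont (δ / 2) (half_pos hδ)
  rw [(hα z₀ hz₀).1] at hε₁δ
  set ε := min ε₁ ε₀ with hε_def
  have hε : 0 < ε := lt_min hε₁ hε₀
  set r' : ℝ := min r (δ / (4 * (L' + 1))) with hr'_def
  have hL'1 : (0 : ℝ) < L' + 1 := by positivity
  have hr' : 0 < r' := lt_min hr (by positivity)
  have hstay : ∀ z ∈ closedBall z₀ r', ∀ t ∈ Ioo (-ε) ε, (α z t).1 ∈ O := by
    intro z hz t ht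
    have hzr : z ∈ closedBall z₀ r := closedBall_subset_closedBall (min_le_left _ _) hz
    have htI : t ∈ Icc (-ε₀) ε₀ :=
      ⟨(neg_le_neg (min_le_right _ _)).trans ht.1.le, ht.2.le.trans (min_le_right _ _)⟩
    have h1 : dist (α z t) (α z₀ t) < δ / 2 := by
      calc dist (α z t) (α z₀ t) ≤ L' * dist z z₀ := (hL' t htI).dist_le_mul z hzr z₀ hz₀
        _ ≤ L' * (δ / (4 * (L' + 1))) := by
          gcongr
          exact (mem_closedBall.1 hz).trans (min_le_right _ _)
        _ = (L' / (L' + 1)) * (δ / 4) := by field_simp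
        _ ≤ 1 * (δ / 4) := by
          gcongr
          exact (div_le_one hL'1).2 (by linarith)
        _ < δ / 2 := by linarith
    have h2 : dist (α z₀ t) z₀ < δ / 2 :=
      hε₁δ (by simpa [Real.dist_eq] using abs_lt.2 ⟨by linarith [ht.1, min_le_left ε₁ ε₀],
        ht.2.trans_le (min_le_left _ _)⟩)
    have h3 : dist (α z t) z₀ < δ :=
      calc dist (α z t) z₀ ≤ dist (α z t) (α z₀ t) + dist (α z₀ t) z₀ := dist_triangle _ _ _
        _ < δ / 2 + δ / 2 := add_lt_add h1 h2
        _ = δ := by ring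
    refine hδO ?_
    rw [mem_ball]
    exact lt_of_le_of_lt (by rw [Prod.dist_eq]; exact le_max_left _ _) h3
  -- the neighbourhood of `p₀`: points whose chart coordinates lie in the closed ball
  set Z : TangentBundle I M → E × E := fun p ↦ (φ p.proj, (e₁ p).2) with hZ_def
  have hp₀ : p₀ ∈ e₁.source := by
    rw [e₁.mem_source, he₁_def, TangentBundle.trivializationAt_baseSet]
    exact mem_chart_source H p₀.proj
  have hZc : ContinuousOn Z e₁.source := by
    refine ContinuousOn.prodMk ?_ ?_
    · refine (continuousOn_extChartAt x₁).comp (FiberBundle.continuous_proj E _).continuousOn ?_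
      intro p hp
      rw [extChartAt_source]
      simpa [he₁_def] using e₁.mem_source.1 hp
    · exact continuous_snd.comp_continuousOn e₁.continuousOn
  have hZ₀ : Z p₀ = z₀ := rfl
  set 𝒰 : Set (TangentBundle I M) := e₁.source ∩ Z ⁻¹' ball z₀ r' with h𝒰_def
  have h𝒰 : 𝒰 ∈ 𝓝 p₀ := by
    refine (hZc.isOpen_inter_preimage e₁.open_source isOpen_ball).mem_nhds ⟨hp₀, ?_⟩
    rw [mem_preimage, hZ₀]
    exact mem_ball_self hr'
  refine ⟨𝒰, h𝒰, ε, hε, fun p hp ↦ ?_⟩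
  -- the geodesic through `p`
  have hpz : Z p ∈ closedBall z₀ r' := ball_subset_closedBall hp.2
  have hpr : Z p ∈ closedBall z₀ r := closedBall_subset_closedBall (min_le_left _ _) hpz
  set f : ℝ → E × E := α (Z p) with hf_def
  have hfd : ∀ t ∈ Ioo (-ε) ε, HasDerivAt f (F (f t)) t := by
    intro t ht
    have htI : t ∈ Ioo (-ε₀) ε₀ :=
      ⟨lt_of_le_of_lt (neg_le_neg (min_le_right _ _)) ht.1, ht.2.trans_le (min_le_right _ _)⟩
    exact ((hα _ hpr).2 t (Ioo_subset_Icc_self htI)).hasDerivAt (Icc_mem_nhds htI.1 htI.2)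
  have hps : p.proj ∈ (chartAt H x₁).source := by
    simpa [he₁_def] using e₁.mem_source.1 hp.1
  obtain ⟨hgeo, hU⟩ := isGeodesicOn_of_chartSolution (cov := cov) b hNs Ĉ hĈ hO hOt hON hOr
    isOpen_Ioo hfd (fun t ht ↦ hstay _ hpz t ht)
  refine ⟨fun t ↦ φ.symm (f t).1, hgeo, ?_⟩
  have h0 : (0 : ℝ) ∈ Ioo (-ε) ε := ⟨by linarith, hε⟩
  have hf0 : f 0 = Z p := (hα _ hpr).1
  have hγ0 : φ.symm (f 0).1 = p.proj := by
    rw [hf0]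
    exact φ.left_inv (by rwa [hφ_def, extChartAt_source])
  refine eq_of_trivializationAt_snd_eq (x₁ := x₁) (by simpa only [tangentLift_proj] using hγ0 ▸ hps)
    hγ0 ?_
  rw [hU 0 h0, hf0]

/-- **Uniform existence time on compact sets of initial data** (Lee, *Introduction to
Riemannian Manifolds* (2018), Lemma 6.19, the fact behind the escape lemma; O'Neill 1983, Ch. 3,
Lemma 22). For a `C¹` connection on a Hausdorff manifold without boundary and a compact set
`𝒦 ⊆ TM`, there is `ε > 0` such that every `p ∈ 𝒦` is the tangent lift at `0` of a geodesic of
`cov` defined on `(-ε, ε)`: cover `𝒦` by finitely many of the neighbourhoods of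
`exists_nhds_uniform_isGeodesicOn` and take the least of their times.
[cite: ONeill1983, Ch. 3, Lemma 22] -/
theorem exists_uniform_isGeodesicOn_of_isCompact [CompleteSpace E] [T2Space M]
    [BoundarylessManifold I M] [CovariantDerivative.ContMDiffCovariantDerivative cov 1]
    {𝒦 : Set (TangentBundle I M)} (h𝒦 : IsCompact 𝒦) :
    ∃ ε > (0 : ℝ), ∀ p ∈ 𝒦, ∃ γ : ℝ → M, IsGeodesicOn cov γ (Ioo (-ε) ε) ∧ tangentLift I γ 0 = p := by
  classical
  choose 𝒰 h𝒰 ε hε hγ using fun p : TangentBundle I M ↦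
    exists_nhds_uniform_isGeodesicOn (cov := cov) p BoundarylessManifold.isInteriorPoint
  obtain ⟨t, -, ht⟩ := h𝒦.elim_nhds_subcover 𝒰 fun p _ ↦ h𝒰 p
  by_cases hte : t = ∅
  · refine ⟨1, one_pos, fun p hp ↦ ?_⟩
    have := ht hp
    simp [hte] at this
  · have hne : t.Nonempty := Finset.nonempty_iff_ne_empty.2 hte
    refine ⟨t.inf' hne ε, (Finset.lt_inf'_iff hne).2 fun q _ ↦ hε q, fun p hp ↦ ?_⟩
    obtain ⟨q, hq, hpq⟩ := mem_iUnion₂.1 (ht hp)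
    obtain ⟨γ, hγq, hγ0⟩ := hγ q p hpq
    refine ⟨γ, hγq.mono (Ioo_subset_Ioo ?_ ?_), hγ0⟩
    · exact neg_le_neg (Finset.inf'_le ε hq)
    · exact Finset.inf'_le ε hq

end Literature.Geometry.Lorentzian

end
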